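import Summits.NavierStokesRegularity.NavierStokesRegularity.Theses.RellichScar
import Summits.NavierStokesRegularity.NavierStokesRegularity.Theorems.SqueezeCycleRecurrentLiouvilleOrbitContinuous
import Literature.Analysis.FluidPDE.SelfSimilar

set_option linter.dupNamespace false

/-!
# Crux `SymmetricScarExists` (stmt-NavierStokesRegularity-11718), line `rdss-screw-split` — stub
# `stub_dilationContinuity` (AUX-2): continuity of the parabolic dilation group on `L³(Q(0, R))`

Helper file of the line lead (`--supports stmt-NavierStokesRegularity-11718`; theorems only, no definitions,
no named facts), pure real analysis.  For a space–time field `u : ℝ → ℝ³ → ℝ³` lying in `L³(Q(0, R))` for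
every `R > 0` (`Q(0, R) = ]-R², 0[ × B(0, R)` = `parabolicCylinder R 0`) and a sequence of positive factors
`c_j → 1`, the parabolic dilations `D_{c_j} u`, `(D_c u)(t, x) = c u(c² t, c x)` (`nsRescale c u`), converge
to `u` in `L³(Q(0, R))` for every `R > 0`:
`‖D_{c_j} u − u‖_{L³(Q(0,R))} → 0` (`stub_dilationContinuity`).

This is the sequential form of the strong continuity at `c = 1` of the scaling orbit `c ↦ D_c u` in
`L³(Q(0, R))`, already in the tree as
`Summit.NavierStokesRegularity.NavierStokesRegularity.Theorems.stub_rlOrbitContinuous` (the classical `3ε`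
argument: truncate to `Q(0, 2R)`, approximate in `L³` by a continuous compactly supported field, use the exact
scaling law `eLpNorm_zoom_sub_zoom` for the two outer terms and uniform continuity for the middle one); the
sequential statement is its composition with `c_j → 1`.

## References

* W. Rudin, *Real and Complex Analysis*, 3rd ed., Thm. 9.5 (continuity of translation in `L^p`). [folklore]
-/

noncomputable section

open MeasureTheory Set Function Filter Topology TopologicalSpace Metric
open scoped NNReal ENNReal

namespace Summit.NavierStokesRegularity.NavierStokesRegularity.Theorems.SymmetricScarExists.RdssSplit.NearIdentity

open Literature.Analysis.FluidPDE

/-- AUX-2 `stub_dilationContinuity` — **continuity of the parabolic dilation in `L³(Q(0,R))`** at a field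
with `u ∈ L³(Q(0,R))` for every `R`: `‖c_j u(c_j² t, c_j x) − u(t,x)‖_{L³(Q(0,R))} → 0` when `c_j → 1`
(`c_j > 0`).  Sequential form of the strong continuity of the scaling orbit at `c = 1`
(`stub_rlOrbitContinuous`: density of continuous compactly supported fields in `L³`, uniform continuity,
and the exact scaling law `eLpNorm_zoom_sub_zoom` for the remainder), composed with `c_j → 1`. [folklore] -/
theorem stub_dilationContinuity :
    ∀ (u : ℝ → EuclideanSpace ℝ (Fin 3) → EuclideanSpace ℝ (Fin 3)), (∀ R : ℝ, 0 < R → MeasureTheory.MemLp (Function.uncurry u) 3 (MeasureTheory.volume.restrict (Literature.Analysis.FluidPDE.parabolicCylinder R (0 : ℝ × EuclideanSpace ℝ (Fin 3))))) → ∀ (c : ℕ → ℝ), (∀ j : ℕ, 0 < c j) → Filter.Tendsto c Filter.atTop (nhds 1) → ∀ R : ℝ, 0 < R → Filter.Tendsto (fun j : ℕ => MeasureTheory.eLpNorm (Function.uncurry (Literature.Analysis.FluidPDE.nsRescale (c j) u) - Function.uncurry u) 3 (MeasureTheory.volume.restrict (Literature.Analysis.FluidPDE.parabolicCylinder R (0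 : ℝ × EuclideanSpace ℝ (Fin 3))))) Filter.atTop (nhds 0) := by
  intro u hu c _ hc R hR
  exact (Summit.NavierStokesRegularity.NavierStokesRegularity.Theorems.stub_rlOrbitContinuous u hu R hR).comp hc

end Summit.NavierStokesRegularity.NavierStokesRegularity.Theorems.SymmetricScarExists.RdssSplit.NearIdentity
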